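import Summits.HubbardSuperconductivity.HubbardSuperconductivity.Theorems.LogColdTorusUniformDescent
import Summits.HubbardSuperconductivity.HubbardSuperconductivity.Theorems.LogColdTorusLogColdToGroundStubGibbsDerivCovariance
import Mathlib.MeasureTheory.Integral.IntervalIntegral.FundThmCalculus

/-!
# Budget descent to the ground state (crux `LogColdToGround`, stmt-HubbardSuperconductivity-8808, route `LogColdTorus`)

The glue node `MonotoneToGround` of the route's two-layer plan for the DESCENT crux, in budget form,
for an arbitrary finite-dimensional Gibbs state, PROVED unconditionally: since `β ↦ ω_β(O)` has
derivative `-Cov_β(H, O)` for every observable `O` (the thermodynamic identity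
`d/dβ ⟨O⟩_β = -(⟨HO⟩_β - ⟨H⟩_β⟨O⟩_β)`, stub A of line `registered`, landed as
`Summit.HubbardSuperconductivity.LogColdToGround.Thermo.stub_gibbsDerivCovariance`), if the energy–`A`
covariance integrated from `β₀` to any colder `β` is at most `B` and `b ≤ Re ω_{β₀}(A)`, then
`b - B ≤ Re ω₀(A)` for the tracial ground-state functional `ω₀` of the Hermitian `H` (fundamental
theorem of calculus + the zero-temperature limit `le_re_groundStateFunctional_of_forall_ge`):
`covarianceBudget_descent` (registered helper of the crux item).  The pointwise-sign corollary
(`Cov ≤ 0` below `T₀ = 1/β₀` ⇒ the order at `β₀` survives to `T = 0`, the route's `MonotoneToGround`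
node verbatim) is `monotone_descent`; `budget_descent` is the same with the derivative formula kept
as a hypothesis (the form used inside the registered skeleton `Cruxes/LogColdToGround/Lines/birth.lean`).
With these, the crux `LogColdToGround` is literally `stub_pairOrderCovarianceBudget` (the physics) and
nothing else.

Sources: O. Bratteli, D. W. Robinson, *Operator Algebras and QSM II*, §5.3.1; H. Tasaki, *Physics and
Mathematics of Quantum Many-Body Systems* (2020), App. A.
-/

set_option linter.dupNamespace false

noncomputable section

namespace Summit.HubbardSuperconductivity.HubbardSuperconductivity.Theorems.LogColdTorus

open Matrix Filter Topology MeasureTheory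

/-- **Budget descent.** If every Gibbs expectation `β ↦ ω_β(O)` of the Hermitian `H` has derivative
`-(ω_β(H O) - ω_β(H) ω_β(O))`, the integrated energy–`A` covariance `∫_{β₀}^{β} Re Cov_s(H, A) ds` is
at most `B` for every `β ≥ β₀`, and `b ≤ Re ω_{β₀}(A)`, then `b - B ≤ Re ω₀(A)` for the tracial
ground-state functional: by the fundamental theorem of calculus
`Re ω_β(A) = Re ω_{β₀}(A) - ∫_{β₀}^{β} Re Cov ≥ b - B` for all `β ≥ β₀`, and `ω_β → ω₀` as `β → ∞`.
Bratteli–Robinson II §5.3.1; Tasaki (2020) App. A. -/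
theorem budget_descent {m : Type*} [Fintype m] [DecidableEq m] {H : Matrix m m ℂ}
    (hH : H.IsHermitian) (A : Matrix m m ℂ) (b B β₀ : ℝ)
    (hderiv : ∀ (O : Matrix m m ℂ) (β : ℝ), HasDerivAt (fun t : ℝ => Matrix.gibbsState t H O)
      (-(Matrix.gibbsState β H (H * O) - Matrix.gibbsState β H H * Matrix.gibbsState β H O)) β)
    (hbudget : ∀ β : ℝ, β₀ ≤ β →
      ∫ s in β₀..β, (Matrix.gibbsState s H (H * A) -
        Matrix.gibbsState s H H * Matrix.gibbsState s H A).re ≤ B)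
    (hb : b ≤ (Matrix.gibbsState β₀ H A).re) :
    b - B ≤ (H.groundStateFunctional A).re := by
  -- Gibbs expectations are continuous in `β` (differentiable ⇒ continuous)
  have hcont : ∀ O : Matrix m m ℂ, Continuous fun t : ℝ => Matrix.gibbsState t H O := fun O =>
    continuous_iff_continuousAt.mpr fun t => (hderiv O t).continuousAt
  -- the covariance density is continuous
  have hcov_cont : Continuous fun s : ℝ =>
      (Matrix.gibbsState s H (H * A) - Matrix.gibbsState s H H * Matrix.gibbsState s H A).re :=
    Complex.continuous_re.comp ((hcont (H * A)).sub ((hcont H).mul (hcont A)))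
  -- the real order parameter has derivative `-Re Cov`
  have hre : ∀ β : ℝ, HasDerivAt (fun t : ℝ => (Matrix.gibbsState t H A).re)
      (-(Matrix.gibbsState β H (H * A) - Matrix.gibbsState β H H * Matrix.gibbsState β H A).re) β :=
    fun β => (Complex.reCLM.hasFDerivAt.comp_hasDerivAt β (hderiv A β)).congr_deriv (by simp)
  -- fundamental theorem of calculus on `[β₀, β]`
  have hftc : ∀ β : ℝ, ∫ s in β₀..β,
      -(Matrix.gibbsState s H (H * A) - Matrix.gibbsState s H H * Matrix.gibbsState s H A).re =
        (Matrix.gibbsState β H A).re - (Matrix.gibbsState β₀ H A).re := fun β =>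
    intervalIntegral.integral_eq_sub_of_hasDerivAt (f := fun t : ℝ => (Matrix.gibbsState t H A).re)
      (fun x _ => hre x) (hcov_cont.neg.intervalIntegrable _ _)
  refine le_re_groundStateFunctional_of_forall_ge hH A (b - B) β₀ fun β hβ => ?_
  have h1 := hftc β
  rw [intervalIntegral.integral_neg] at h1
  have h2 := hbudget β hβ
  linarith

/-- **Monotone descent** (the pointwise-sign form of the route's `MonotoneToGround`): if every Gibbs
expectation of the Hermitian `H` has derivative `-Cov_β(H, ·)`, the energy–`A` covariance is
non-positive at every `β ≥ β₀` (cooling below `T₀ = 1/β₀` never decreases `Re ω_β(A)`), and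
`b ≤ Re ω_{β₀}(A)`, then `b ≤ Re ω₀(A)`. Bratteli–Robinson II §5.3.1; Tasaki (2020) App. A. -/
theorem monotone_descent {m : Type*} [Fintype m] [DecidableEq m] {H : Matrix m m ℂ}
    (hH : H.IsHermitian) (A : Matrix m m ℂ) (b β₀ : ℝ)
    (hderiv : ∀ (O : Matrix m m ℂ) (β : ℝ), HasDerivAt (fun t : ℝ => Matrix.gibbsState t H O)
      (-(Matrix.gibbsState β H (H * O) - Matrix.gibbsState β H H * Matrix.gibbsState β H O)) β)
    (hsign : ∀ s : ℝ, β₀ ≤ s →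
      (Matrix.gibbsState s H (H * A) - Matrix.gibbsState s H H * Matrix.gibbsState s H A).re ≤ 0)
    (hb : b ≤ (Matrix.gibbsState β₀ H A).re) :
    b ≤ (H.groundStateFunctional A).re := by
  have key := budget_descent hH A b 0 β₀ hderiv (fun β hβ => ?_) hb
  · simpa using key
  · calc ∫ s in β₀..β, (Matrix.gibbsState s H (H * A) -
          Matrix.gibbsState s H H * Matrix.gibbsState s H A).re
        ≤ ∫ _ in β₀..β, (0 : ℝ) :=
          intervalIntegral.integral_mono_on hβ ?_ (by simp) fun s hs => hsign s hs.1
      _ = 0 := by simp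
    have hcont : ∀ O : Matrix m m ℂ, Continuous fun t : ℝ => Matrix.gibbsState t H O := fun O =>
      continuous_iff_continuousAt.mpr fun t => (hderiv O t).continuousAt
    exact (Complex.continuous_re.comp ((hcont (H * A)).sub ((hcont H).mul (hcont A)))).intervalIntegrable _ _

/-- **Covariance-budget descent, unconditional** (registered helper `covarianceBudget_descent` of
crux stmt-HubbardSuperconductivity-8808): for a Hermitian matrix `H`, any matrix `A` and reals
`b, B, β₀`, if `∫_{β₀}^{β} Re(ω_s(H A) - ω_s(H) ω_s(A)) ds ≤ B` for every `β ≥ β₀` and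
`b ≤ Re ω_{β₀}(A)`, then `b - B ≤ Re ω₀(A)` (`ω₀ = Matrix.groundStateFunctional H`).  The derivative
formula `d/dβ ω_β(O) = -Cov_β(H, O)` is the landed stub A.  Bratteli–Robinson II §5.3.1;
Tasaki (2020) App. A. -/
theorem covarianceBudget_descent : ∀ {m : Type} {_ : Fintype m} {_ : DecidableEq m}
    (H A : Matrix m m ℂ), H.IsHermitian → ∀ (b B β₀ : ℝ),
    (∀ β : ℝ, β₀ ≤ β → ∫ s in β₀..β, (Matrix.gibbsState s H (H * A) -
        Matrix.gibbsState s H H * Matrix.gibbsState s H A).re ≤ B) →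
    b ≤ (Matrix.gibbsState β₀ H A).re → b - B ≤ (H.groundStateFunctional A).re :=
  fun H A hH b B β₀ hbudget hb => budget_descent hH A b B β₀
    (fun O β => Summit.HubbardSuperconductivity.LogColdToGround.Thermo.stub_gibbsDerivCovariance H O hH β)
    hbudget hb

/-- **Monotone descent, unconditional** (the route's `MonotoneToGround` node): for a Hermitian `H`,
if the energy–`A` covariance `Re(ω_s(H A) - ω_s(H) ω_s(A))` is `≤ 0` for every `s ≥ β₀` (cooling
below `T₀ = 1/β₀` never decreases `Re ω_s(A)`) and `b ≤ Re ω_{β₀}(A)`, then `b ≤ Re ω₀(A)`.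
Bratteli–Robinson II §5.3.1; Tasaki (2020) App. A. -/
theorem monotone_descent' {m : Type*} [Fintype m] [DecidableEq m] {H : Matrix m m ℂ}
    (hH : H.IsHermitian) (A : Matrix m m ℂ) (b β₀ : ℝ)
    (hsign : ∀ s : ℝ, β₀ ≤ s →
      (Matrix.gibbsState s H (H * A) - Matrix.gibbsState s H H * Matrix.gibbsState s H A).re ≤ 0)
    (hb : b ≤ (Matrix.gibbsState β₀ H A).re) :
    b ≤ (H.groundStateFunctional A).re :=
  monotone_descent hH A b β₀
    (fun O β => Summit.HubbardSuperconductivity.LogColdToGround.Thermo.hasDerivAt_gibbsState_inverseTemp H O hH β)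
    hsign hb

end Summit.HubbardSuperconductivity.HubbardSuperconductivity.Theorems.LogColdTorus

end
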